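import Literature.NumberTheory.Automorphic.QuaternionLocalSplit
import HarnessLib

/-!
# Maximal orders are locally conjugate at a split prime
# (Vignéras, LNM 800, Ch. II §2 Thm. 2.3 (1) with Ch. III §5 Prop. 5.1)

Topic `NumberTheory/Automorphic`; theorems only (no definition, no named fact, no instance).
Let `B` be a division quaternion algebra over `ℚ`, `p` a prime with a matrix model
`φ : B → M₂(ℚ_p)` (i.e. `B` split at `p`), and `O₁, O₂` maximal `ℤ`-orders of `B`. By the tree's
`IsMaximalZOrder.exists_conjUnit_localAt_iff` (`QuaternionLocalSplit.lean`: Vignéras II §2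
Lemme 2.1 / Thm. 2.3 (1), "les ordres maximaux de `M(2,K)` sont conjugués à `M(2,R)`", patched to
the localisation of a global maximal order by III §5 Prop. 5.1) there are `u₁, u₂ ∈ GL₂(ℚ_p)` with
`O_k,₍ₚ₎ = {x | u_k⁻¹ φ(x) u_k ∈ M₂(ℤ_p)}`. Approximating `u₂ u₁⁻¹` by `φ(b)`, `b ∈ B`
(density, `AlgHom.exists_norm_sub_le`) so well that `w = u₂⁻¹ φ(b) u₁ ∈ 1 + p M₂(ℤ_p) ⊆ GL₂(ℤ_p)`,
we get **`O₂,₍ₚ₎ = b O₁,₍ₚ₎ b⁻¹` with `b ∈ Bˣ`**: the two maximal orders are conjugate locally at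
`p` by a unit of the *global* algebra (the form consumed by the gluing theorem
`exists_isInvertibleRightIdeal_leftOrderOf_eq` of `ConnectingIdeal.lean`).

* `Padic.norm_det_eq_one_of_norm_sub_one_lt`, `Padic.norm_inv_apply_le_one`,
  `Padic.forall_norm_conj_apply_le_one_iff` — `2 × 2` bookkeeping over `ℚ_p`
  (`1 + p M₂(ℤ_p) ⊆ GL₂(ℤ_p)`; conjugation by `GL₂(ℤ_p)` preserves `M₂(ℤ_p)`);
* `IsMaximalZOrder.exists_localAt_eq_conj_of_algHom` — **Thm. 2.3 (1), global form at one
  split prime**: `∃ x ∈ Bˣ, O₂,₍ₚ₎ = x O₁,₍ₚ₎ x⁻¹`;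
* `IsMaximalZOrder.exists_locallyConjugate` — **at all primes at once**: if at every prime where
  `O₁,₍q₎ ≠ O₂,₍q₎` a matrix model `B → M₂(ℚ_q)` is available (at a ramified prime two maximal
  orders have the same localisation, `IsMaximalZOrder.localAt_eq_of_not_isSplitAt`), then there
  are a finite set `S` of primes and units `x_q` with `O₂,₍q₎ = x_q O₁,₍q₎ x_q⁻¹` for `q ∈ S` and
  `O₂,₍q₎ = O₁,₍q₎` for the primes `q ∉ S` — the hypotheses of `ConnectingIdeal.lean`: any two
  maximal orders of a definite quaternion algebra over `ℚ` are in the same genus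
  (Vignéras III §5 B: "les ordres maximaux … forment un seul genre").

## References

* M.-F. Vignéras, *Arithmétique des algèbres de quaternions*, LNM 800 (1980), Ch. II §2
  Thm. 2.3, Ch. III §5 Prop. 5.1 and §5 B [VignerasLNM800].
* J. Voight, *Quaternion Algebras*, GTM 288 (2021), Thm. 10.5.5 (`p`-adic maximal orders are
  conjugate), 17.4 (genus of maximal orders) [Voight2021].
-/

noncomputable section

open scoped Pointwise

universe u

namespace Literature.NumberTheory.Automorphic

/-! ### `2 × 2` matrices over `ℚ_p`: `1 + p M₂(ℤ_p) ⊆ GL₂(ℤ_p)` -/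

section PadicMatrix

variable {p : ℕ} [hp : Fact p.Prime]

/-- Every matrix has a common bound for the norms of its entries. [folklore] -/
theorem Padic.exists_forall_norm_apply_le (M : Matrix (Fin 2) (Fin 2) ℚ_[p]) :
    ∃ a : ℝ, 0 ≤ a ∧ ∀ i j, ‖M i j‖ ≤ a := by
  refine ⟨∑ i, ∑ j, ‖M i j‖,
    Finset.sum_nonneg fun i _ => Finset.sum_nonneg fun j _ => norm_nonneg _, fun i j => ?_⟩
  calc ‖M i j‖ ≤ ∑ j', ‖M i j'‖ :=
        Finset.single_le_sum (f := fun j' => ‖M i j'‖) (fun _ _ => norm_nonneg _)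
          (Finset.mem_univ j)
    _ ≤ ∑ i', ∑ j', ‖M i' j'‖ :=
        Finset.single_le_sum (f := fun i' => ∑ j', ‖M i' j'‖)
          (fun _ _ => Finset.sum_nonneg fun _ _ => norm_nonneg _) (Finset.mem_univ i)

/-- Entrywise bound for a product of `2 × 2` matrices over `ℚ_p` (ultrametric inequality):
entries of `M N` have norm `≤ a b` if those of `M` are `≤ a` and those of `N` are `≤ b`.
[folklore] -/
theorem Padic.norm_mul_apply_le {M N : Matrix (Fin 2) (Fin 2) ℚ_[p]} {a b : ℝ}
    (hM : ∀ i j, ‖M i j‖ ≤ a) (hN : ∀ i j, ‖N i j‖ ≤ b) (ha : 0 ≤ a) (i j : Fin 2) :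
    ‖(M * N) i j‖ ≤ a * b := by
  rw [Matrix.mul_apply, Fin.sum_univ_two]
  refine (Padic.nonarchimedean _ _).trans (max_le ?_ ?_) <;> rw [norm_mul] <;>
    exact mul_le_mul (hM _ _) (hN _ _) (norm_nonneg _) ha

/-- If `w ≡ 1 (mod p M₂(ℤ_p))` entrywise (`‖(w - 1)_{ij}‖ < 1`), then `‖det w‖ = 1`. [folklore] -/
theorem Padic.norm_det_eq_one_of_norm_sub_one_lt {w : Matrix (Fin 2) (Fin 2) ℚ_[p]}
    (h : ∀ i j, ‖(w - 1) i j‖ < 1) : ‖w.det‖ = 1 := by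
  set η : Matrix (Fin 2) (Fin 2) ℚ_[p] := w - 1 with hη
  have hw : w = 1 + η := by rw [hη, add_sub_cancel]
  have h01 : (0 : Fin 2) ≠ 1 := by decide
  have hdet : w.det = 1 + (η 0 0 + η 1 1 + η 0 0 * η 1 1 + -(η 0 1 * η 1 0)) := by
    rw [hw, Matrix.det_fin_two]
    simp only [Matrix.add_apply, Matrix.one_apply_eq, Matrix.one_apply_ne h01,
      Matrix.one_apply_ne h01.symm, zero_add]
    ring
  -- the bracket is small
  have hadd : ∀ a b : ℚ_[p], ‖a‖ < 1 → ‖b‖ < 1 → ‖a + b‖ < 1 := fun a b ha hb =>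
    (Padic.nonarchimedean a b).trans_lt (max_lt ha hb)
  have hmul : ∀ a b : ℚ_[p], ‖a‖ < 1 → ‖b‖ < 1 → ‖a * b‖ < 1 := fun a b ha hb => by
    rw [norm_mul]
    exact mul_lt_one_of_nonneg_of_lt_one_left (norm_nonneg a) ha hb.le
  have hs : ‖η 0 0 + η 1 1 + η 0 0 * η 1 1 + -(η 0 1 * η 1 0)‖ < 1 := by
    refine hadd _ _ (hadd _ _ (hadd _ _ (h 0 0) (h 1 1)) (hmul _ _ (h 0 0) (h 1 1))) ?_
    rw [norm_neg]
    exact hmul _ _ (h 0 1) (h 1 0)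
  rw [hdet, Padic.add_eq_max_of_ne (by rw [norm_one]; exact hs.ne'), norm_one,
    max_eq_left hs.le]

/-- An integral `2 × 2` matrix over `ℚ_p` with unit determinant has an integral inverse
(`w⁻¹ = (det w)⁻¹ adj w`). [folklore] -/
theorem Padic.norm_inv_apply_le_one {w : Matrix (Fin 2) (Fin 2) ℚ_[p]} (hw : ∀ i j, ‖w i j‖ ≤ 1)
    (hdet : ‖w.det‖ = 1) (i j : Fin 2) : ‖w⁻¹ i j‖ ≤ 1 := by
  rw [Matrix.inv_def, Ring.inverse_eq_inv, Matrix.smul_apply, smul_eq_mul, norm_mul, norm_inv,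
    hdet, inv_one, one_mul, Matrix.adjugate_fin_two]
  fin_cases i <;> fin_cases j <;> simp [norm_neg, hw]

/-- Conjugation by an element of `GL₂(ℤ_p)` (an integral matrix `w` with integral two-sided
inverse `w'`) preserves integrality: `w' M w ∈ M₂(ℤ_p) ↔ M ∈ M₂(ℤ_p)`. [folklore] -/
theorem Padic.forall_norm_conj_apply_le_one_iff {w w' M : Matrix (Fin 2) (Fin 2) ℚ_[p]}
    (hw : ∀ i j, ‖w i j‖ ≤ 1) (hw' : ∀ i j, ‖w' i j‖ ≤ 1) (h₂ : w * w' = 1) :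
    (∀ i j, ‖(w' * M * w) i j‖ ≤ 1) ↔ ∀ i j, ‖M i j‖ ≤ 1 := by
  refine ⟨fun h => ?_, fun h => Padic.norm_mul_apply_le_one (Padic.norm_mul_apply_le_one hw' h) hw⟩
  have hM : M = w * (w' * M * w) * w' := by
    rw [← mul_assoc, ← mul_assoc, h₂, one_mul, mul_assoc, h₂, mul_one]
  rw [hM]
  exact Padic.norm_mul_apply_le_one (Padic.norm_mul_apply_le_one hw h) hw'

end PadicMatrix

/-! ### Thm. 2.3 (1), global form: maximal orders are conjugate locally at a split prime -/

section Split

variable {B : Type u} [Ring B] [Algebra ℚ B] [IsQuaternionAlgebra ℚ B] {p : ℕ} [hp : Fact p.Prime]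

local notation "M₂" => Matrix (Fin 2) (Fin 2) ℚ_[p]

omit [Algebra ℚ B] [IsQuaternionAlgebra ℚ B] in
/-- Membership in the conjugate lattice `x (L) x⁻¹ = x • (op x⁻¹ • L)`: `y ∈ x L x⁻¹ ↔ x⁻¹ y x ∈ L`.
[folklore] -/
theorem mem_units_smul_op_smul_iff (x : Bˣ) (L : Submodule ℤ B) (y : B) :
    y ∈ x • (MulOpposite.op ((x⁻¹ : Bˣ) : B) • L) ↔ (↑x⁻¹ : B) * y * x ∈ L := by
  rw [mem_units_smul_submodule_iff, mem_op_units_smul_submodule_iff, inv_inv, Units.smul_def,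
    smul_eq_mul]

/-- **Maximal orders are conjugate locally at a split prime, by a unit of `B`** (Vignéras II §2
Thm. 2.3 (1) with III §5 Prop. 5.1): for a division quaternion algebra `B` over `ℚ` with a matrix
model `φ : B → M₂(ℚ_p)` and maximal `ℤ`-orders `O₁, O₂`, there is `x ∈ Bˣ` with
`O₂,₍ₚ₎ = x O₁,₍ₚ₎ x⁻¹`. [cite: VignerasLNM800, Ch. II §2 Thm. 2.3 (1) and Ch. III §5 Prop. 5.1] -/
theorem IsMaximalZOrder.exists_localAt_eq_conj_of_algHom (hdiv : ∀ x : B, x ≠ 0 → IsUnit x)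
    {O₁ O₂ : Submodule ℤ B} (hO₁ : IsMaximalZOrder O₁) (hO₂ : IsMaximalZOrder O₂)
    (φ : B →ₐ[ℚ] Matrix (Fin 2) (Fin 2) ℚ_[p]) :
    ∃ x : Bˣ, localAt p O₂ = x • (MulOpposite.op ((x⁻¹ : Bˣ) : B) • localAt p O₁) := by
  have hpp : p.Prime := hp.out
  obtain ⟨u₁, hu₁⟩ := hO₁.exists_conjUnit_localAt_iff hdiv φ
  obtain ⟨u₂, hu₂⟩ := hO₂.exists_conjUnit_localAt_iff hdiv φ
  -- entrywise bounds for `u₂⁻¹` and `u₁`, and a precision `k` with `a c p^{-k} < 1`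
  obtain ⟨a, ha0, ha⟩ := Padic.exists_forall_norm_apply_le (↑u₂⁻¹ : M₂)
  obtain ⟨c, hc0, hc⟩ := Padic.exists_forall_norm_apply_le (u₁ : M₂)
  obtain ⟨k, hk⟩ : ∃ k : ℕ, a * c * (p : ℝ) ^ (-(k : ℤ)) < 1 := by
    obtain ⟨k, hk⟩ := pow_unbounded_of_one_lt (a * c) (by exact_mod_cast hpp.one_lt : (1 : ℝ) < p)
    refine ⟨k, ?_⟩
    rw [zpow_neg, zpow_natCast, mul_inv_lt_iff₀ (pow_pos (by exact_mod_cast hpp.pos) k), one_mul]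
    exact hk
  -- `φ(b) = u₂ u₁⁻¹ + δ` with `δ` small
  obtain ⟨b, hb⟩ := AlgHom.exists_norm_sub_le φ ((u₂ : M₂) * (↑u₁⁻¹ : M₂)) k
  set δ : M₂ := φ b - (u₂ : M₂) * (↑u₁⁻¹ : M₂) with hδ
  have hφb : φ b = (u₂ : M₂) * (↑u₁⁻¹ : M₂) + δ := by rw [hδ, add_sub_cancel]
  -- `w = u₂⁻¹ φ(b) u₁ = 1 + u₂⁻¹ δ u₁ ∈ GL₂(ℤ_p)`
  set w : M₂ := (↑u₂⁻¹ : M₂) * φ b * (u₁ : M₂) with hw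
  have hw1 : w - 1 = (↑u₂⁻¹ : M₂) * δ * (u₁ : M₂) := by
    rw [hw, hφb, mul_add, add_mul, ← mul_assoc, Units.inv_mul, one_mul, Units.inv_mul,
      add_sub_cancel_left]
  have hsmall : ∀ i j, ‖(w - 1) i j‖ < 1 := fun i j => by
    rw [hw1]
    calc ‖((↑u₂⁻¹ : M₂) * δ * (u₁ : M₂)) i j‖
          ≤ a * (p : ℝ) ^ (-(k : ℤ)) * c :=
          Padic.norm_mul_apply_le (Padic.norm_mul_apply_le ha hb ha0) hc
            (mul_nonneg ha0 (zpow_nonneg (Nat.cast_nonneg p) _)) i j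
      _ = a * c * (p : ℝ) ^ (-(k : ℤ)) := by ring
      _ < 1 := hk
  have hwint : ∀ i j, ‖w i j‖ ≤ 1 := fun i j => by
    rw [← sub_add_cancel w 1, Matrix.add_apply]
    refine (Padic.nonarchimedean _ _).trans (max_le (hsmall i j).le ?_)
    rw [Matrix.one_apply]
    split_ifs <;> simp
  have hdet : ‖w.det‖ = 1 := Padic.norm_det_eq_one_of_norm_sub_one_lt hsmall
  have hdetU : IsUnit w.det := isUnit_iff_ne_zero.mpr fun h0 => by
    rw [h0, norm_zero] at hdet
    exact zero_ne_one hdet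
  -- `b` is a unit of `B`
  have hb0 : b ≠ 0 := by
    rintro rfl
    refine hdetU.ne_zero ?_
    rw [hw, map_zero, mul_zero, zero_mul, Matrix.det_zero]
  obtain ⟨x, hx⟩ := hdiv b hb0
  -- the explicit inverse `w' = u₁⁻¹ φ(x⁻¹) u₂` of `w`
  set w' : M₂ := (↑u₁⁻¹ : M₂) * φ ↑x⁻¹ * (u₂ : M₂) with hw'
  have hxx' : φ b * φ (↑x⁻¹ : B) = 1 := by rw [← hx, ← map_mul, Units.mul_inv, map_one]
  have h₂ : w * w' = 1 := by
    calc w * w' = (↑u₂⁻¹ : M₂) * (φ b * ((u₁ : M₂) * (↑u₁⁻¹ : M₂)) * φ ↑x⁻¹) * (u₂ : M₂) := by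
          rw [hw, hw']; simp only [mul_assoc]
      _ = 1 := by rw [Units.mul_inv, mul_one, hxx', mul_one, Units.inv_mul]
  have hw'eq : w⁻¹ = w' := Matrix.inv_eq_right_inv h₂
  have hw'int : ∀ i j, ‖w' i j‖ ≤ 1 := by
    rw [← hw'eq]
    exact Padic.norm_inv_apply_le_one hwint hdet
  refine ⟨x, Submodule.ext fun y => ?_⟩
  rw [mem_units_smul_op_smul_iff, hu₂, hu₁]
  have key : (AlgHom.conjUnit φ u₁) ((↑x⁻¹ : B) * y * x) = w' * (AlgHom.conjUnit φ u₂) y * w := by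
    rw [AlgHom.conjUnit_apply, AlgHom.conjUnit_apply, map_mul, map_mul, hx, hw, hw']
    simp only [mul_assoc, Units.mul_inv_cancel_left]
  rw [key]
  exact (Padic.forall_norm_conj_apply_le_one_iff hwint hw'int h₂).symm

/-! ### All primes at once: two maximal orders are in the same genus -/

omit hp in
/-- **Any two maximal orders of a definite quaternion algebra over `ℚ` are locally conjugate at
every prime, by units of `B`, and equal locally at almost every prime** — provided a matrix model
`B → M₂(ℚ_q)` is available at each prime `q` where they differ locally (at a ramified prime two
maximal orders coincide locally, `IsMaximalZOrder.localAt_eq_of_not_isSplitAt`, so this asks for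
splitness only where it holds). Output in the format of `exists_isInvertibleRightIdeal_leftOrderOf_eq`
(`ConnectingIdeal.lean`): Vignéras III §5 B, the maximal orders form a single genus.
[cite: VignerasLNM800, Ch. III §5 B (genre des ordres maximaux)] -/
theorem IsMaximalZOrder.exists_locallyConjugate (hdiv : ∀ x : B, x ≠ 0 → IsUnit x)
    {O₁ O₂ : Submodule ℤ B} (hO₁ : IsMaximalZOrder O₁) (hO₂ : IsMaximalZOrder O₂)
    (hsplit : ∀ (q : ℕ) [Fact q.Prime], localAt q O₂ ≠ localAt q O₁ →
      Nonempty (B →ₐ[ℚ] Matrix (Fin 2) (Fin 2) ℚ_[q])) :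
    ∃ (x : ℕ → Bˣ) (S : Finset ℕ), (∀ q ∈ S, q.Prime) ∧
      (∀ q ∈ S, localAt q O₂ = x q • (MulOpposite.op (((x q)⁻¹ : Bˣ) : B) • localAt q O₁)) ∧
      ∀ q : ℕ, q.Prime → q ∉ S → localAt q O₂ = localAt q O₁ := by
  classical
  -- local conjugacy wherever the localisations differ
  have hconj : ∀ q : ℕ, q.Prime → ∃ x : Bˣ,
      localAt q O₂ = x • (MulOpposite.op ((x⁻¹ : Bˣ) : B) • localAt q O₁) := by
    intro q hq
    haveI : Fact q.Prime := ⟨hq⟩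
    by_cases hne : localAt q O₂ = localAt q O₁
    · exact ⟨1, by rw [hne, inv_one, Units.val_one, MulOpposite.op_one, one_smul, one_smul]⟩
    · obtain ⟨φ⟩ := hsplit q hne
      exact hO₁.exists_localAt_eq_conj_of_algHom hdiv hO₂ φ
  choose! x hx using hconj
  -- commensurability: `m O₂ ⊆ O₁`, `m' O₁ ⊆ O₂`; outside `m m'` the localisations agree
  obtain ⟨n, hn0, hn⟩ := exists_smul_mem_of_fg hO₁.1.isFullLattice hO₂.1.isFullLattice.1
  obtain ⟨n', hn'0, hn'⟩ := exists_smul_mem_of_fg hO₂.1.isFullLattice hO₁.1.isFullLattice.1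
  have habs : ∀ (k : ℤ) (L L' : Submodule ℤ B), (∀ y ∈ L, k • y ∈ L') →
      ∀ y ∈ L, ((k.natAbs : ℕ) : ℤ) • y ∈ L' := fun k L L' h y hy => by
    rcases Int.natAbs_eq k with h1 | h1
    · rw [← h1]; exact h y hy
    · rw [neg_eq_iff_eq_neg.mp h1.symm, neg_smul]; exact L'.neg_mem (h y hy)
  set m : ℕ := n.natAbs with hmdef
  set m' : ℕ := n'.natAbs with hm'def
  have hm0 : m ≠ 0 := Int.natAbs_ne_zero.mpr hn0
  have hm'0 : m' ≠ 0 := Int.natAbs_ne_zero.mpr hn'0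
  refine ⟨x, (m * m').primeFactors, fun q hq => Nat.prime_of_mem_primeFactors hq,
    fun q hq => hx q (Nat.prime_of_mem_primeFactors hq), fun q hq hqS => ?_⟩
  have hndvd : ¬ q ∣ m * m' := fun h => hqS (Nat.mem_primeFactors.mpr ⟨hq, h, mul_ne_zero hm0 hm'0⟩)
  have hcop : m.Coprime q :=
    Nat.Coprime.symm ((Nat.Prime.coprime_iff_not_dvd hq).mpr fun h => hndvd (h.mul_right m'))
  have hcop' : m'.Coprime q :=
    Nat.Coprime.symm ((Nat.Prime.coprime_iff_not_dvd hq).mpr fun h => hndvd (h.mul_left m))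
  exact localAt_eq_of_smul_le_of_smul_le hm'0 hm0 (habs n' O₁ O₂ hn') (habs n O₂ O₁ hn) hcop' hcop

end Split

end Literature.NumberTheory.Automorphic

end
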